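/-
COR-CM (cell pub-hodgecm2, stage 2 of the Hodge ladder) — count-neutral KERNEL COMBINATORICS «the binary tetrahedral group SL(2,3)», part X: GENERATION in the
model (seat prover-pub-hodgecm2-b23-g53-0, binder prover b23, gen 53; claim HOME/INBOX.md l.24246, NAME ASK l.24300).  Bookkeeping definitions with bodies
(`repOf`, `redFace`; `redFaces`, `genFamily` irreducible finite sets over the closed finite type `Block`) + theorems — gen 45ʼs `Census/OcticProductGeneration.lean` for the motions of part IV (`A = ℤ/3`, shear `1`) and
the eight closing faces of part VII; on gen 44ʼs label-level lane BY NAME; no `decide` beyond closed identities in `Fin 4`, no certificate, no named fact,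
no `sorry`.  `Interfaces.lean` (C1), every E term, B01, `Transposition/*`, `PortJoin/*`, `D2Bridge/*` untouched.
HONEST FRAMING: `HC_CM` is NOT proved, here or anywhere in the tree; nothing here is a period, a count of record or a headline.
T5: n/a-class (no hypothesis binders); checker: self.
-/
import Summits.HodgeConjecture.CorCM.Census.OcticProductGeneration
import Summits.HodgeConjecture.CorCM.Census.BinaryTetrahedralLattice
import Summits.HodgeConjecture.CorCM.Census.BinaryTetrahedralBlocks

/-!
# The binary tetrahedral group, X: GENERATION — the Hodge lattice of the model is spanned, modulo pairs, by the translates of one reducing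
# face per non-residual block and the eight closing faces

THE MODEL of `SL(2,3)` is part IVʼs with `A = ℤ/3`, shear `σ = 1`; blocks are part IXʼs; `B1` is part VIIʼs closing family.
* §1 The span of gen 44ʼs reducing faces is stable under the sheared translation, hence under every motion; the functionals kill it.
* §2 **The block faces**: one reducing face (gen 44ʼs `exists_reducing`) through a representative of every non-residual block; their orbit span covers
  every non-residual label by a potential-lowering vector (covers move along chains of motions).
* §3 **GENERATION** (`hodge₄_le`): `hodge₄ ≤ pairs₄ ⊔ orbSpan (redFaces ∪ B1)` — for `x ∈ hodge₄`, part VIII gives `c ∈ orbSpan B1` with the same values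
  under every functional; gen 44ʼs descent reduces `x − c` modulo `orbSpan redFaces` to a residual vector, killed by every functional, hence a sum of
  pairs by gen 44ʼs key lemma.
* §4 **THE COUNT** (`card_genFamily_add_two_le`): the family has at most `#Block − 2` members (part IX: ten residual blocks, eight closing faces); every
  member is a face `faceVec₄ Θ p q`, `p ≠ q`, of the model (`genFamily_shape`).
All [folklore] bookkeeping over [Pohlmann1968, Thm 1].

## References
* [Pohlmann1968] H. Pohlmann, Algebraic cycles on abelian varieties of complex multiplication type, Ann. of Math. 88 (1968), Thm 1.
-/

namespace Summit.HodgeConjecture.CorCM.Census.BinaryTetrahedral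

open Finset
open Summit.HodgeConjecture.CorCM.Census.OddSliceFacesModel
open Summit.HodgeConjecture.CorCM.Census.QuarticInversion
open Summit.HodgeConjecture.CorCM.Census.OcticProduct (twZ twZinv twZ_twZinv twZinv_twZ translZ pot₄_twZ translZ_mem_span_redSet cover_translZ)

noncomputable section

/-! ## §1 Reducing faces under the motions -/

/-- **The span of the reducing faces is stable under the sheared translation.** [folklore] -/
theorem translA_mem_span_redSet {A : Type} [AddCommGroup A] [Fintype A] [DecidableEq A] (hA : Odd (Fintype.card A)) (σ : A) {v : Ty₄ A → ℤ}
    (hv : v ∈ Submodule.span ℤ (redSet A)) : translA A σ v ∈ Submodule.span ℤ (redSet A) := by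
  have hle : (Submodule.span ℤ (redSet A)).map (translAHom A σ) ≤ Submodule.span ℤ (redSet A) := by
    rw [Submodule.map_span]
    refine Submodule.span_mono ?_
    rintro _ ⟨u, ⟨Θ, p, q, h, rfl⟩, rfl⟩
    exact ⟨twA A σ Θ, plA A σ p, plA A σ q, reducing_twA A hA σ h, by rw [translAHom_apply, translA_faceVec₄]⟩
  exact hle (Submodule.mem_map_of_mem (f := translAHom A σ) hv)

/-! ## §2 The block faces and their covering property -/

/-- A label in each block (a choice). [folklore] -/
def repOf (B : Block) : Ty₄ (ZMod 3) := Quotient.out B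

/-- `repOf B` lies in `B`. [folklore] -/
theorem blk_repOf (B : Block) : blk (repOf B) = B := Quotient.out_eq B

/-- The potential of the representative is the potential of the block. [folklore] -/
theorem pot₄_repOf (B : Block) : pot₄ (ZMod 3) (repOf B) = potB B := by
  rw [← potB_blk, blk_repOf]

/-- **The block face**: gen 44ʼs reducing face through the representative (junk `0` for residual blocks). [folklore] -/
def redFace (B : Block) : Ty₄ (ZMod 3) → ℤ :=
  if h : 2 ≤ pot₄ (ZMod 3) (repOf B) then
    faceVec₄ (ZMod 3) (repOf B) (Classical.choose (exists_reducing (ZMod 3) h))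
      (Classical.choose (Classical.choose_spec (exists_reducing (ZMod 3) h)))
  else 0

/-- The block face of a non-residual block is a reducing face through its representative. [folklore] -/
theorem redFace_spec {B : Block} (hB : 2 ≤ potB B) :
    ∃ p q, (p ≠ q ∧ ∀ c, pot₄ (ZMod 3) (corner (ZMod 3) (repOf B) p q c) < pot₄ (ZMod 3) (repOf B) ∧
      ∀ n, half (ZMod 3) (coord (ZMod 3) n (corner (ZMod 3) (repOf B) p q c)) = half (ZMod 3) (coord (ZMod 3) n (repOf B))) ∧
      redFace B = faceVec₄ (ZMod 3) (repOf B) p q := by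
  have h : 2 ≤ pot₄ (ZMod 3) (repOf B) := by rw [pot₄_repOf]; exact hB
  refine ⟨_, _, Classical.choose_spec (Classical.choose_spec (exists_reducing (ZMod 3) h)), ?_⟩
  rw [redFace, dif_pos h]

/-- **The block faces**: one per non-residual block (irreducible: the finite quotient type `Block` is closed, and unfolding a membership
`v ∈ redFaces` by `whnf` would enumerate it). [folklore] -/
@[irreducible] def redFaces : Finset (Ty₄ (ZMod 3) → ℤ) := (univ.filter fun B : Block => 2 ≤ potB B).image redFace

/-- Membership in the block faces. [folklore] -/
theorem mem_redFaces {v : Ty₄ (ZMod 3) → ℤ} : v ∈ redFaces ↔ ∃ B : Block, 2 ≤ potB B ∧ redFace B = v := by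
  unfold redFaces
  simp only [Finset.mem_image, Finset.mem_filter, Finset.mem_univ, true_and]

/-- There are at most as many block faces as non-residual blocks. [folklore] -/
theorem card_redFaces_le : redFaces.card ≤ (univ.filter fun B : Block => 2 ≤ potB B).card := by
  unfold redFaces
  exact Finset.card_image_le

/-- Block faces are reducing faces. [folklore] -/
theorem redFaces_subset_redSet : (↑redFaces : Set (Ty₄ (ZMod 3) → ℤ)) ⊆ redSet (ZMod 3) := by
  intro v hv
  obtain ⟨B, hB, rfl⟩ := mem_redFaces.mp (Finset.mem_coe.mp hv)
  obtain ⟨p, q, h, e⟩ := redFace_spec hB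
  exact ⟨_, p, q, h, e⟩

/-- Block faces are Hodge vectors. [folklore] -/
theorem redFaces_subset_hodge₄ : (↑redFaces : Set (Ty₄ (ZMod 3) → ℤ)) ⊆ hodge₄ (ZMod 3) := by
  intro v hv
  obtain ⟨Θ, p, q, h, rfl⟩ := redFaces_subset_redSet hv
  exact faceVec₄_mem (ZMod 3) Θ h.1

/-- The orbit span of the block faces lies in the span of all reducing faces. [folklore] -/
theorem orbSpan_redFaces_le : orbSpan (ZMod 3) 1 ↑redFaces ≤ Submodule.span ℤ (redSet (ZMod 3)) :=
  orbSpan_le (ZMod 3) 1 (fun _ hv => Submodule.subset_span (redFaces_subset_redSet hv))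
    (fun ζ _ hv => translH₄_mem_span_redSet (ZMod 3) odd_card_zmod_three (ζ, 0) hv)
    (fun _ hv => translZ_mem_span_redSet (ZMod 3) 1 odd_card_zmod_three hv)
    (fun _ hv => translT_mem_span_redSet (ZMod 3) odd_card_zmod_three hv)
    (fun _ hv => translA_mem_span_redSet odd_card_zmod_three 1 hv)

/-- A covering vector moves with the sheared translation. [folklore] -/
theorem cover_translA {v : Ty₄ (ZMod 3) → ℤ} {Θ : Ty₄ (ZMod 3)}
    (hv : v Θ = 1 ∧ ∀ χ, χ ≠ Θ → v χ ≠ 0 → pot₄ (ZMod 3) χ < pot₄ (ZMod 3) Θ) :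
    translA (ZMod 3) 1 v (twA (ZMod 3) 1 Θ) = 1 ∧
      ∀ χ, χ ≠ twA (ZMod 3) 1 Θ → translA (ZMod 3) 1 v χ ≠ 0 → pot₄ (ZMod 3) χ < pot₄ (ZMod 3) (twA (ZMod 3) 1 Θ) := by
  have e : ∀ χ, translA (ZMod 3) 1 v χ = v (twAinv (ZMod 3) 1 χ) := fun χ => rfl
  refine ⟨by rw [e, twAinv_twA]; exact hv.1, fun χ hχ hne => ?_⟩
  rw [e] at hne
  have hχ' : twAinv (ZMod 3) 1 χ ≠ Θ := fun h => hχ (by rw [← h, twA_twAinv])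
  have := hv.2 _ hχ' hne
  rwa [← pot₄_twA (ZMod 3) 1 (twAinv (ZMod 3) 1 χ), twA_twAinv, ← pot₄_twA (ZMod 3) 1 Θ] at this

/-- **Covers move along chains of motions** inside an orbit span. [folklore] -/
theorem cover_of_reach (F : Set (Ty₄ (ZMod 3) → ℤ)) {Θ Θ' : Ty₄ (ZMod 3)} (hreach : blk Θ = blk Θ')
    (hcov : ∃ v ∈ orbSpan (ZMod 3) 1 F, v Θ = 1 ∧ ∀ χ, χ ≠ Θ → v χ ≠ 0 → pot₄ (ZMod 3) χ < pot₄ (ZMod 3) Θ) :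
    ∃ v ∈ orbSpan (ZMod 3) 1 F, v Θ' = 1 ∧ ∀ χ, χ ≠ Θ' → v χ ≠ 0 → pot₄ (ZMod 3) χ < pot₄ (ZMod 3) Θ' := by
  rw [blk_eq_blk_iff] at hreach
  induction hreach with
  | refl => exact hcov
  | tail _ hs ih =>
    obtain ⟨v, hvF, hv⟩ := ih
    rcases hs with ⟨ζ, rfl⟩ | rfl | rfl | rfl
    · exact ⟨_, translH₄_mem_orbSpan (ZMod 3) 1 F ζ hvF, cover_translH₄ (ZMod 3) (ζ, 0) hv⟩
    · exact ⟨_, translZ_mem_orbSpan (ZMod 3) 1 F hvF, cover_translZ (ZMod 3) 1 hv⟩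
    · exact ⟨_, translT_mem_orbSpan (ZMod 3) 1 F hvF, cover_translT (ZMod 3) hv⟩
    · exact ⟨_, translA_mem_orbSpan (ZMod 3) 1 F hvF, cover_translA hv⟩

/-- **The orbit span of the block faces covers every non-residual label.** [folklore] -/
theorem redFaces_cover (Ψ : Ty₄ (ZMod 3)) (hΨ : 2 ≤ pot₄ (ZMod 3) Ψ) :
    ∃ v ∈ orbSpan (ZMod 3) 1 ↑redFaces, v Ψ = 1 ∧ ∀ χ, χ ≠ Ψ → v χ ≠ 0 → pot₄ (ZMod 3) χ < pot₄ (ZMod 3) Ψ := by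
  set B := blk Ψ with hBdef
  have hB : 2 ≤ potB B := by rw [hBdef, potB_blk]; exact hΨ
  obtain ⟨p, q, h, e⟩ := redFace_spec hB
  refine cover_of_reach _ (blk_repOf B) ⟨redFace B, subset_orbSpan (ZMod 3) 1 _ ?_, ?_⟩
  · exact Finset.mem_coe.mpr (mem_redFaces.mpr ⟨B, hB, rfl⟩)
  · rw [e]; exact faceVec₄_reducing (ZMod 3) fun c => (h.2 c).1

/-! ## §3 Generation -/

/-- **The generating family**: the block faces and the eight closing faces (irreducible, like `redFaces`). [folklore] -/
@[irreducible] def genFamily : Finset (Ty₄ (ZMod 3) → ℤ) := redFaces ∪ famB1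

/-- Membership in the family. [folklore] -/
theorem mem_genFamily {f : Ty₄ (ZMod 3) → ℤ} : f ∈ genFamily ↔ f ∈ redFaces ∨ f ∈ famB1 := by
  unfold genFamily
  exact Finset.mem_union

/-- The family has at most `#redFaces + #B1` members. [folklore] -/
theorem card_genFamily_le_add : genFamily.card ≤ redFaces.card + famB1.card := by
  unfold genFamily
  exact Finset.card_union_le _ _

/-- The block faces belong to the family. [folklore] -/
theorem redFaces_subset_genFamily : (↑redFaces : Set (Ty₄ (ZMod 3) → ℤ)) ⊆ ↑genFamily := fun _ hf =>
  Finset.mem_coe.mpr (mem_genFamily.mpr (Or.inl (Finset.mem_coe.mp hf)))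

/-- The closing faces belong to the family. [folklore] -/
theorem famB1_subset_genFamily : (↑famB1 : Set (Ty₄ (ZMod 3) → ℤ)) ⊆ ↑genFamily := fun _ hf =>
  Finset.mem_coe.mpr (mem_genFamily.mpr (Or.inr (Finset.mem_coe.mp hf)))

/-- **GENERATION: `hodge₄ ≤ pairs₄ ⊔ orbSpan (redFaces ∪ B1)`.** [folklore] -/
theorem hodge₄_le : hodge₄ (ZMod 3) ≤ pairs₄ (ZMod 3) ⊔ orbSpan (ZMod 3) 1 ↑genFamily := by
  have hA := odd_card_zmod_three
  have h3 := three_le_card_zmod_three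
  intro x hx
  obtain ⟨c, hc, hAc⟩ := Submodule.mem_map.mp (Avec_mem_valMod_of_hodge hx)
  have hcH : c ∈ hodge₄ (ZMod 3) := orbSpan_le_hodge₄ (ZMod 3) 1 famB1_subset_hodge₄ hc
  obtain ⟨r, hres, hmem⟩ := descent_of_cover (pot₄ (ZMod 3)) (orbSpan (ZMod 3) 1 ↑redFaces) redFaces_cover
    (4 * Fintype.card (ZMod 3)) (x - c) (fun χ _ => pot₄_le (ZMod 3) χ)
  have hkill := killed_of_mem (ZMod 3) hA (Submodule.mem_sup_right (orbSpan_redFaces_le hmem))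
  have hval : ∀ w', (fnl (ZMod 3) w' x = fnl (ZMod 3) w' c) → fnl (ZMod 3) w' (x - c - r) = 0 → fnl (ZMod 3) w' r = 0 := by
    intro w' h h'
    rw [map_sub, map_sub, h, sub_self, zero_sub, neg_eq_zero] at h'
    exact h'
  have hkA : ∀ j η u, fnl (ZMod 3) (wA (ZMod 3) j η u) r = 0 := fun j η u =>
    hval _ (by have := congrFun hAc (Sum.inl (j, η, u)); simpa using this.symm) (hkill.1 j η u)
  have hkC : ∀ η, fnl (ZMod 3) (wC (ZMod 3) η) r = 0 := fun η =>
    hval _ (by have := congrFun hAc (Sum.inr η); simpa using this.symm) (hkill.2 η)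
  have hr : r ∈ pairs₄ (ZMod 3) := mem_pairs₄_of_killed (ZMod 3) hA h3 hres hkA hkC
  have e : x = c + (x - c - r) + r := by abel
  rw [e]
  refine Submodule.add_mem _ (Submodule.add_mem _ (Submodule.mem_sup_right ?_) (Submodule.mem_sup_right ?_))
    (Submodule.mem_sup_left hr)
  · exact orbSpan_mono (ZMod 3) 1 famB1_subset_genFamily hc
  · exact orbSpan_mono (ZMod 3) 1 redFaces_subset_genFamily hmem

/-! ## §4 The count and the shape of the family -/

/-- **`#family + 2 ≤ #Block`**: at most `#Block − 10` block faces (part IX) and at most eight closing faces. [folklore] -/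
theorem card_genFamily_add_two_le : genFamily.card + 2 ≤ Fintype.card Block := by
  have hu := card_genFamily_le_add
  have hb := card_redFaces_le
  have hf := card_famB1_le
  have hten := ten_le_card_residual
  have hpart := Finset.card_filter_add_card_filter_not (s := (univ : Finset Block)) (fun B => potB B < 2)
  have hneg : (univ.filter fun B : Block => ¬ potB B < 2) = univ.filter fun B : Block => 2 ≤ potB B := by
    refine Finset.filter_congr fun B _ => ?_; omega
  rw [hneg, Finset.card_univ] at hpart
  omega

/-- The family consists of faces of the model: `faceVec₄ Θ p q` with `p ≠ q`. [folklore] -/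
theorem genFamily_shape {f : Ty₄ (ZMod 3) → ℤ} (hf : f ∈ genFamily) : ∃ Θ p q, p ≠ q ∧ f = faceVec₄ (ZMod 3) Θ p q := by
  rcases mem_genFamily.mp hf with hf | hf
  · obtain ⟨Θ, p, q, h, e⟩ := redFaces_subset_redSet (Finset.mem_coe.mpr hf)
    exact ⟨Θ, p, q, h.1, e⟩
  · obtain ⟨k, -, rfl⟩ := Finset.mem_image.mp hf
    fin_cases k
    · exact ⟨_, _, _, by decide, rfl⟩
    · exact ⟨_, _, _, by decide, rfl⟩
    · exact ⟨_, _, _, by decide, rfl⟩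
    · exact ⟨_, _, _, by decide, rfl⟩
    · exact ⟨_, _, _, by decide, rfl⟩
    · exact ⟨_, _, _, by decide, rfl⟩
    · exact ⟨_, _, _, by decide, rfl⟩
    · exact ⟨_, _, _, by decide, rfl⟩

end

end Summit.HodgeConjecture.CorCM.Census.BinaryTetrahedral
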